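import Mathlib
import Summits.ResolutionOfSingularities.ResolutionOfSingularities.Theorems.FrobeniusClosingSteerEmptyStallTwo
import Summits.ResolutionOfSingularities.ResolutionOfSingularities.Theorems.PAlterationPicoverLocalModelDegenerateExit
import Literature.AlgebraicGeometry.Resolution.AdicCompletionRegular
import Literature.AlgebraicGeometry.Resolution.RegularLocalRingsProofs
import Literature.AlgebraicGeometry.Resolution.RegularLocalRingsQuotient
import Literature.AlgebraicGeometry.Resolution.EtaleLocalAlgebra
import Literature.AlgebraicGeometry.Resolution.RsopMonomialIdeals
import HarnessLib

/-!
# Crux `Steer` (stmt-ResolutionOfSingularities-16345), line `switching_dichotomy` — the CLOSED-POINT DICTIONARY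

Helper for chain W4.1 (res-L0-w41-plan-1 RULINGS 05:44:37Z (3); phrasing of res-D-pv-028 05:39:07Z):
the dictionary between the R1 PHASE-MACHINE predicates of the holder's skeleton (r20 §B: `GenAt`,
`OrderOneGen`, `ExitAt` — "some generator of the torsor is in order-one form") and the σ-side GERM
predicate (`IsSingPrime S p f 𝔪` of res-L0-w41-plan-1's `Sketch-R2-steered.lean` §3.2 —
"`S_𝔪[T]/(T^p − f)` is not regular"), all with their bodies UNFOLDED as binders so that the holder's
leaves are by `exact`. OURS — statements about the route's own objects; nothing here is a statement of
the manuscript under review.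

* `isRsopPart_one_iff` — a one-element family is part of a regular system of parameters of a regular
  local ring iff the element lies in `𝔪 ∖ 𝔪²` (Matsumura 14.2).
* `forall_sub_pow_not_mem_sq` — ONE cleaning of order one forbids ALL cleanings of order `≥ 2`:
  `f − g₀^p ∈ 𝔪 ∖ 𝔪²` ⇒ `∀ g, f − g^p ∉ 𝔪²` (`g^p − g₀^p = (g − g₀)^p ∈ 𝔪 ⇒ ∈ 𝔪^p ⊆ 𝔪²`).
* `orderOneGen_iff` — `OrderOneGen S p s'` ⟺ (`s'^p` has a cleaning in `𝔪`) ∧ (no cleaning in `𝔪²`).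
* `isRegularLocalRing_germ_of_orderOneGen` — an order-one generator has a REGULAR torsor germ over
  `S_𝔪` (⇐ half of the criterion, `EmptyStallTwo.…`, p499359): `OrderOneGen ⇒ ¬ IsSingPrime 𝔪`.
* `not_isRegularLocalRing_adjoinRoot_of_sub_pow_mem_sq` (+ the exact-power case) — the ⇒ half of the
  criterion: a cleaning in `𝔪²` makes the cover singular (embedding dimension jumps, tree
  `PicoverLocalModel.DegenerateExit`; or a non-zero nilpotent when `f = g^p`).
* `orderOneGen_of_isRegularLocalRing_germ` — conversely, when the residue of `s'^p` is a `p`-th power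
  (automatic for a PERFECT residue field, `exists_pow_eq_residue_of_perfectField`), a regular germ
  makes `s'` an order-one generator: `¬ IsSingPrime 𝔪 ⇒ OrderOneGen`.
* run level: `exitAt_of_steeredExitAt` (`GenAt (R N) p t (s N) ∧ SteeredExitAt R p s N ⇒ ExitAt (R N) p t`,
  perfect residue field) and `isSingPrime_of_not_exitAt` (`GenAt ∧ ¬ ExitAt ⇒ IsSingPrime (R N) p ((s N)^p) 𝔪`).

Consumers: the odd-`p` unified machine (B′ `SteeredStallRebase`: the stall datum re-enters the phase
machine through `concl_or_coreDatum`), the Φ4-literal pieces, the σ-residual shapes PT₁/ALT₁/WANDER₁.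
-/

-- The namespace mirrors the chain's helper layout (`…Theorems.SwitchingDichotomy.<Piece>`) on purpose.
set_option linter.dupNamespace false

noncomputable section

namespace Summit.ResolutionOfSingularities.ResolutionOfSingularities.Theorems.SwitchingDichotomy.ClosedPointDictionary

open Polynomial IsLocalRing Literature.AlgebraicGeometry.Resolution

universe u

/-! ## One-element parts of regular systems of parameters -/

/-- **A single element is part of a regular system of parameters of a regular local ring iff it lies
in `𝔪 ∖ 𝔪²`** (Matsumura 14.2 for one element: `R/(x)` is regular of dimension `dim R − 1`).
[cite: Matsumura1987, Thm. 14.2] -/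
theorem isRsopPart_one_iff {R : Type u} [CommRing R] [IsRegularLocalRing R] (x : R) :
    IsRsopPart (fun _ : Fin 1 => x) ↔ x ∈ maximalIdeal R ∧ x ∉ maximalIdeal R ^ 2 := by
  constructor
  · intro h
    exact ⟨h.mem_maximalIdeal 0, h.not_mem_sq 0⟩
  · rintro ⟨hx, hx2⟩
    have hrange : Set.range (fun _ : Fin 1 => x) = {x} := by
      ext y
      simp
    rw [isRsopPart_iff_quotient, hrange]
    obtain ⟨hreg, hdim⟩ := IsRegularLocalRing.quotient_span_singleton hx hx2
    exact ⟨fun _ => hx, hreg, by exact_mod_cast hdim⟩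

/-- A family on `Fin 1` is the constant family of its value. [folklore] -/
theorem eq_const_of_fin_one {α : Type u} (z : Fin 1 → α) : z = fun _ => z 0 :=
  funext fun i => by rw [Subsingleton.elim i 0]

/-! ## One cleaning of order one forbids every cleaning of order `≥ 2` -/

/-- In a local ring of prime characteristic `p`: if `f − g₀^p ∈ 𝔪 ∖ 𝔪²` for one `g₀`, then
`f − g^p ∉ 𝔪²` for EVERY `g` — indeed `g^p − g₀^p = (g − g₀)^p` would lie in `𝔪`, hence in
`𝔪^p ⊆ 𝔪²`. [folklore] -/
theorem forall_sub_pow_not_mem_sq {R : Type u} [CommRing R] [IsLocalRing R] (p : ℕ) [Fact p.Prime]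
    [CharP R p] (f g₀ : R) (h₀ : f - g₀ ^ p ∈ maximalIdeal R) (h₀' : f - g₀ ^ p ∉ maximalIdeal R ^ 2) :
    ∀ g : R, f - g ^ p ∉ maximalIdeal R ^ 2 := by
  intro g hg
  have hp : p.Prime := Fact.out
  apply h₀'
  -- `(g − g₀)^p ∈ 𝔪`, hence `g − g₀ ∈ 𝔪`
  have h1 : (g - g₀) ^ p ∈ maximalIdeal R := by
    rw [sub_pow_char]
    have : g ^ p - g₀ ^ p = (f - g₀ ^ p) - (f - g ^ p) := by ring
    rw [this]
    exact Ideal.sub_mem _ h₀ (Ideal.pow_le_self two_ne_zero hg)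
  have h2 : g - g₀ ∈ maximalIdeal R := (maximalIdeal.isMaximal R).isPrime.mem_of_pow_mem p h1
  have h3 : (g - g₀) ^ p ∈ maximalIdeal R ^ 2 :=
    Ideal.pow_le_pow_right hp.two_le (Ideal.pow_mem_pow h2 p)
  have : f - g₀ ^ p = (f - g ^ p) + (g - g₀) ^ p := by
    rw [sub_pow_char]
    ring
  rw [this]
  exact Ideal.add_mem _ hg h3

/-! ## `OrderOneGen` unfolded -/

section Subring

variable {K : Type u} [Field K]

/-- **`OrderOneGen S p s'` read on the radicand** (`OrderOneGen` of the holder's r20 §B, body unfolded):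
for a regular local subring `S ⊆ K` of prime characteristic `p` and `s'` with `s'^p ∈ S`, some cleaning
`s'^p − g^p` (`g ∈ S`) is a one-element part of a regular system of parameters iff `s'^p` has a cleaning
in `𝔪` and no cleaning in `𝔪²`. [folklore] -/
theorem orderOneGen_iff (p : ℕ) [Fact p.Prime] [CharP K p] (S : Subring K) [IsLocalRing S]
    (hreg : IsRegularLocalRing S) (s' : K) (hs : s' ^ p ∈ S) :
    (∃ g ∈ S, ∃ (_ : IsLocalRing S) (z : Fin 1 → S), IsRsopPart z ∧ ((z 0 : S) : K) = s' ^ p - g ^ p) ↔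
      (∃ g : S, (⟨s' ^ p, hs⟩ : S) - g ^ p ∈ maximalIdeal S) ∧
        ∀ g : S, (⟨s' ^ p, hs⟩ : S) - g ^ p ∉ maximalIdeal S ^ 2 := by
  haveI := hreg
  constructor
  · rintro ⟨g, hg, _, z, hz, hz0⟩
    have hzeq : z 0 = (⟨s' ^ p, hs⟩ : S) - ⟨g, hg⟩ ^ p := Subtype.ext (by simpa using hz0)
    rw [eq_const_of_fin_one z, isRsopPart_one_iff, hzeq] at hz
    exact ⟨⟨⟨g, hg⟩, hz.1⟩, forall_sub_pow_not_mem_sq p _ _ hz.1 hz.2⟩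
  · rintro ⟨⟨g, hgm⟩, hall⟩
    refine ⟨g, g.2, inferInstance, fun _ => (⟨s' ^ p, hs⟩ : S) - g ^ p, ?_, by simp⟩
    exact (isRsopPart_one_iff _).mpr ⟨hgm, hall g⟩

/-- **An order-one generator has a regular torsor germ** (`OrderOneGen S p s' ⇒ ¬ IsSingPrime S p (s'^p) 𝔪`,
bodies unfolded): the ⇐ half of the singularity criterion
(`EmptyStallTwo.isRegularLocalRing_adjoinRoot_localization_of_forall_not_mem_sq`, p499359). [folklore] -/
theorem isRegularLocalRing_germ_of_orderOneGen (p : ℕ) [Fact p.Prime] [CharP K p] (S : Subring K)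
    [IsLocalRing S] (hreg : IsRegularLocalRing S) (s' : K) (hs : s' ^ p ∈ S)
    (h : ∃ g ∈ S, ∃ (_ : IsLocalRing S) (z : Fin 1 → S), IsRsopPart z ∧ ((z 0 : S) : K) = s' ^ p - g ^ p) :
    IsRegularLocalRing (AdjoinRoot ((X : (Localization.AtPrime (maximalIdeal S))[X]) ^ p -
      C (algebraMap S (Localization.AtPrime (maximalIdeal S)) ⟨s' ^ p, hs⟩))) :=
  haveI := hreg
  EmptyStallTwo.isRegularLocalRing_adjoinRoot_localization_of_forall_not_mem_sq p _
    ((orderOneGen_iff p S hreg s' hs).mp h).2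

end Subring

/-! ## The ⇒ half of the criterion: a cleaning in `𝔪²` makes the cover singular -/

/-- **An exact `p`-th power gives a non-reduced cover**: for a regular local ring `R` of prime
characteristic `p` and `g ∈ R`, `R[T]/(T^p − g^p)` is not a regular local ring — the class of `T − g`
is nilpotent and non-zero (degree `1 < p`), while regular local rings are domains.
[cite: Matsumura1987, Thm. 14.3] -/
theorem not_isRegularLocalRing_adjoinRoot_X_pow_sub_C_pow {R : Type u} [CommRing R]
    [IsRegularLocalRing R] (p : ℕ) [Fact p.Prime] [CharP R p] (g : R) :
    ¬ IsRegularLocalRing (AdjoinRoot ((X : R[X]) ^ p - C (g ^ p))) := by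
  intro hreg
  have hp : p.Prime := Fact.out
  haveI : IsDomain R := isDomain_of_isRegularLocalRing R
  set f : R[X] := X ^ p - C (g ^ p) with hf
  haveI : IsDomain (AdjoinRoot f) := isDomain_of_isRegularLocalRing _
  have hθp : (AdjoinRoot.root f - AdjoinRoot.of f g) ^ p = 0 := by
    rw [hf, PicoverLocalModel.TransversalExit.root_sub_of_pow_eq p (g ^ p) g, sub_self, map_zero]
  have hθ0 : AdjoinRoot.root f - AdjoinRoot.of f g = 0 := pow_eq_zero_iff (hp.ne_zero) |>.mp hθp
  have hmk : AdjoinRoot.mk f (X - C g) = 0 := by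
    rw [map_sub, AdjoinRoot.mk_X, AdjoinRoot.mk_C]
    exact hθ0
  rw [AdjoinRoot.mk_eq_zero] at hmk
  have hdeg := natDegree_le_of_dvd hmk (X_sub_C_ne_zero g)
  rw [hf, natDegree_X_pow_sub_C, natDegree_X_sub_C] at hdeg
  exact absurd hdeg (not_le.mpr hp.one_lt)

/-- **A cleaning of order `≥ 2` makes the cover singular**: for a regular local ring `R` of prime
characteristic `p` and `f, g ∈ R` with `f − g^p ∈ 𝔪²`, `R[T]/(T^p − f)` is not a regular local ring
(`f = g^p`: non-reduced; else `dim R ≥ 1` and the embedding dimension jumps,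
`PicoverLocalModel.DegenerateExit.not_isRegularLocalRing_adjoinRoot_of_mem_sq`). [folklore] -/
theorem not_isRegularLocalRing_adjoinRoot_of_sub_pow_mem_sq {R : Type u} [CommRing R]
    [IsRegularLocalRing R] (p : ℕ) [Fact p.Prime] [CharP R p] (f g : R)
    (h : f - g ^ p ∈ maximalIdeal R ^ 2) :
    ¬ IsRegularLocalRing (AdjoinRoot ((X : R[X]) ^ p - C f)) := by
  by_cases hfg : f = g ^ p
  · subst hfg
    exact not_isRegularLocalRing_adjoinRoot_X_pow_sub_C_pow p g
  · haveI : IsDomain R := isDomain_of_isRegularLocalRing R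
    have hne : f - g ^ p ≠ 0 := sub_ne_zero.mpr hfg
    have hm : maximalIdeal R ≠ ⊥ := by
      intro hbot
      apply hne
      have h' : f - g ^ p ∈ maximalIdeal R := Ideal.pow_le_self two_ne_zero h
      rw [hbot] at h'
      exact Ideal.mem_bot.mp h'
    have h1 : (1 : WithBot ℕ∞) ≤ ringKrullDim R := by
      refine Order.one_le_krullDim_iff.mpr ⟨⟨⊥, Ideal.isPrime_bot⟩, ⟨maximalIdeal R, inferInstance⟩, ?_⟩
      exact (PrimeSpectrum.asIdeal_lt_asIdeal _ _).mp (bot_lt_iff_ne_bot.mpr hm)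
    intro hreg
    haveI := hreg
    exact PicoverLocalModel.DegenerateExit.not_isRegularLocalRing_adjoinRoot_of_mem_sq p f g h h1
      (isRegularRing_of_isRegularLocalRing _)

/-- The same over the localisation at the maximal ideal (`R_𝔪 ≅ R`), with the cleaning taken in `R`:
`f − g^p ∈ 𝔪_R²` for some `g ∈ R` ⇒ the germ `R_𝔪[T]/(T^p − f)` is singular (`IsSingPrime R p f 𝔪`
unfolded). [folklore] -/
theorem not_isRegularLocalRing_germ_of_sub_pow_mem_sq {R : Type u} [CommRing R]
    [IsRegularLocalRing R] (p : ℕ) [Fact p.Prime] [CharP R p] (f g : R)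
    (h : f - g ^ p ∈ maximalIdeal R ^ 2) :
    ¬ IsRegularLocalRing (AdjoinRoot ((X : (Localization.AtPrime (maximalIdeal R))[X]) ^ p -
      C (algebraMap R (Localization.AtPrime (maximalIdeal R)) f))) := by
  set L := Localization.AtPrime (maximalIdeal R)
  haveI : IsDomain R := isDomain_of_isRegularLocalRing R
  haveI : IsRegularRing R := isRegularRing_of_isRegularLocalRing R
  haveI : IsRegularLocalRing L := inferInstance
  haveI : CharP L p := charP_of_injective_algebraMap
    (IsLocalization.injective L (maximalIdeal R).primeCompl_le_nonZeroDivisors) p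
  refine not_isRegularLocalRing_adjoinRoot_of_sub_pow_mem_sq p (algebraMap R L f) (algebraMap R L g) ?_
  rw [← map_pow, ← map_sub, ← Localization.AtPrime.map_eq_maximalIdeal, ← Ideal.map_pow]
  exact Ideal.mem_map_of_mem _ h

/-! ## The converse of the dictionary, under a Frobenius-surjective residue field -/

/-- The residue field of a local ring of prime characteristic `p` has characteristic `p`. [folklore] -/
theorem charP_residueField {R : Type u} [CommRing R] [IsLocalRing R] (p : ℕ) [Fact p.Prime]
    [CharP R p] : CharP (ResidueField R) p :=
  ((residue R).comp (ZMod.castHom (dvd_refl p) R)).charP_iff_charP p |>.mp inferInstance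

/-- Over a PERFECT residue field every residue is a `p`-th power. [folklore] -/
theorem exists_pow_eq_residue_of_perfectField {R : Type u} [CommRing R] [IsLocalRing R] (p : ℕ)
    [Fact p.Prime] [CharP R p] [PerfectField (ResidueField R)] (a : ResidueField R) :
    ∃ b : ResidueField R, b ^ p = a := by
  haveI : CharP (ResidueField R) p := charP_residueField p
  haveI : PerfectRing (ResidueField R) p := PerfectField.toPerfectRing p
  obtain ⟨b, hb⟩ := (frobeniusEquiv (ResidueField R) p).surjective a
  exact ⟨b, by simpa [frobenius_def] using hb⟩

section Subring

variable {K : Type u} [Field K]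

/-- **A regular germ makes the generator order-one** when the residue of `s'^p` is a `p`-th power
(`¬ IsSingPrime S p (s'^p) 𝔪 ⇒ OrderOneGen S p s'`, bodies unfolded): regularity of
`S_𝔪[T]/(T^p − s'^p)` forbids cleanings in `𝔪²`, the residue hypothesis gives a cleaning in `𝔪`, and
an element of `𝔪 ∖ 𝔪²` is a one-element part of a regular system of parameters. [folklore] -/
theorem orderOneGen_of_isRegularLocalRing_germ (p : ℕ) [Fact p.Prime] [CharP K p] (S : Subring K)
    [IsLocalRing S] (hreg : IsRegularLocalRing S) (s' : K) (hs : s' ^ p ∈ S)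
    (hres : ∃ b : ResidueField S, b ^ p = residue S ⟨s' ^ p, hs⟩)
    (hgerm : IsRegularLocalRing (AdjoinRoot ((X : (Localization.AtPrime (maximalIdeal S))[X]) ^ p -
      C (algebraMap S (Localization.AtPrime (maximalIdeal S)) ⟨s' ^ p, hs⟩)))) :
    ∃ g ∈ S, ∃ (_ : IsLocalRing S) (z : Fin 1 → S), IsRsopPart z ∧ ((z 0 : S) : K) = s' ^ p - g ^ p := by
  haveI := hreg
  refine (orderOneGen_iff p S hreg s' hs).mpr ⟨?_, fun g hg => ?_⟩
  · obtain ⟨b, hb⟩ := hres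
    obtain ⟨g, rfl⟩ := residue_surjective b
    refine ⟨g, ?_⟩
    rw [← residue_eq_zero_iff, map_sub, map_pow, ← hb, sub_self]
  · exact not_isRegularLocalRing_germ_of_sub_pow_mem_sq p _ g hg hgerm

/-- The same with a PERFECT residue field (e.g. every member of the point or steered sequence of a
core datum over a perfect ground field with `ZeroDim`). [folklore] -/
theorem orderOneGen_of_isRegularLocalRing_germ_of_perfectField (p : ℕ) [Fact p.Prime] [CharP K p]
    (S : Subring K) [IsLocalRing S] (hreg : IsRegularLocalRing S) [PerfectField (ResidueField S)]
    (s' : K) (hs : s' ^ p ∈ S)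
    (hgerm : IsRegularLocalRing (AdjoinRoot ((X : (Localization.AtPrime (maximalIdeal S))[X]) ^ p -
      C (algebraMap S (Localization.AtPrime (maximalIdeal S)) ⟨s' ^ p, hs⟩)))) :
    ∃ g ∈ S, ∃ (_ : IsLocalRing S) (z : Fin 1 → S), IsRsopPart z ∧ ((z 0 : S) : K) = s' ^ p - g ^ p :=
  orderOneGen_of_isRegularLocalRing_germ p S hreg s' hs (exists_pow_eq_residue_of_perfectField p _) hgerm

/-- **The dictionary as an `iff`** (perfect residue field): `s'` is an order-one generator over `S` iff
the torsor germ `S_𝔪[T]/(T^p − s'^p)` is a regular local ring. [folklore] -/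
theorem orderOneGen_iff_isRegularLocalRing_germ (p : ℕ) [Fact p.Prime] [CharP K p] (S : Subring K)
    [IsLocalRing S] (hreg : IsRegularLocalRing S) [PerfectField (ResidueField S)] (s' : K)
    (hs : s' ^ p ∈ S) :
    (∃ g ∈ S, ∃ (_ : IsLocalRing S) (z : Fin 1 → S), IsRsopPart z ∧ ((z 0 : S) : K) = s' ^ p - g ^ p) ↔
      IsRegularLocalRing (AdjoinRoot ((X : (Localization.AtPrime (maximalIdeal S))[X]) ^ p -
        C (algebraMap S (Localization.AtPrime (maximalIdeal S)) ⟨s' ^ p, hs⟩))) :=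
  ⟨isRegularLocalRing_germ_of_orderOneGen p S hreg s' hs,
    orderOneGen_of_isRegularLocalRing_germ_of_perfectField p S hreg s' hs⟩

/-! ## Run level: `ExitAt` versus `SteeredExitAt` -/

/-- **`GenAt ∧ SteeredExitAt ⇒ ExitAt`** (bodies unfolded; perfect residue field): if the torsor generator
`s N` of a steered run is a generator of the torsor of `t` over the member `R N` (`GenAt (R N) p t (s N)`)
and the germ over the closed point of `R N` is regular (`SteeredExitAt R p s N`), then the phase machine
EXITS at `R N` (`ExitAt (R N) p t`). [folklore] -/
theorem exitAt_of_steeredExitAt (p : ℕ) [Fact p.Prime] [CharP K p] (R : ℕ → Subring K) (s : ℕ → K)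
    (N : ℕ) (t : K) [IsLocalRing (R N)] (hreg : IsRegularLocalRing (R N))
    [PerfectField (ResidueField (R N))]
    (hgen : s N ^ p ∈ R N ∧ t ∈ Subring.closure (insert (s N) (R N : Set K)))
    (hexit : ∃ (_ : IsLocalRing (R N)) (hs : s N ^ p ∈ R N),
      ¬ ¬ IsRegularLocalRing (AdjoinRoot ((X : (Localization.AtPrime (maximalIdeal (R N)))[X]) ^ p -
        C (algebraMap (R N) (Localization.AtPrime (maximalIdeal (R N))) ⟨s N ^ p, hs⟩)))) :
    ∃ s' : K, (s' ^ p ∈ R N ∧ t ∈ Subring.closure (insert s' (R N : Set K))) ∧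
      ∃ g ∈ R N, ∃ (_ : IsLocalRing (R N)) (z : Fin 1 → R N),
        IsRsopPart z ∧ ((z 0 : R N) : K) = s' ^ p - g ^ p := by
  obtain ⟨_, hs, hgerm⟩ := hexit
  exact ⟨s N, hgen, orderOneGen_of_isRegularLocalRing_germ_of_perfectField p (R N) hreg (s N) hs
    (not_not.mp hgerm)⟩

/-- **`GenAt ∧ ¬ ExitAt ⇒ IsSingPrime 𝔪`** (bodies unfolded; perfect residue field): if `s N` is a
generator of the torsor of `t` over `R N` and the phase machine does NOT exit at `R N`, then the germ
`(R N)_𝔪[T]/(T^p − (s N)^p)` is singular. [folklore] -/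
theorem isSingPrime_of_not_exitAt (p : ℕ) [Fact p.Prime] [CharP K p] (R : ℕ → Subring K) (s : ℕ → K)
    (N : ℕ) (t : K) [IsLocalRing (R N)] (hreg : IsRegularLocalRing (R N))
    [PerfectField (ResidueField (R N))] (hs : s N ^ p ∈ R N)
    (hgen : s N ^ p ∈ R N ∧ t ∈ Subring.closure (insert (s N) (R N : Set K)))
    (hne : ¬ ∃ s' : K, (s' ^ p ∈ R N ∧ t ∈ Subring.closure (insert s' (R N : Set K))) ∧
      ∃ g ∈ R N, ∃ (_ : IsLocalRing (R N)) (z : Fin 1 → R N),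
        IsRsopPart z ∧ ((z 0 : R N) : K) = s' ^ p - g ^ p) :
    ¬ IsRegularLocalRing (AdjoinRoot ((X : (Localization.AtPrime (maximalIdeal (R N)))[X]) ^ p -
      C (algebraMap (R N) (Localization.AtPrime (maximalIdeal (R N))) ⟨s N ^ p, hs⟩))) := fun hgerm =>
  hne ⟨s N, hgen, orderOneGen_of_isRegularLocalRing_germ_of_perfectField p (R N) hreg (s N) hs hgerm⟩

end Subring

end Summit.ResolutionOfSingularities.ResolutionOfSingularities.Theorems.SwitchingDichotomy.ClosedPointDictionary

end
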